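import Literature.NumberTheory.EllipticCurves.Kato2004.EulerSystemValues
import Literature.NumberTheory.EllipticCurves.Kato2004.H1CoefficientChange
import Literature.NumberTheory.EllipticCurves.QuadraticTwist
import HarnessLib

/-!
# Kato 2004, (8.1.3) / Example 13.3 with Prop. 8.12, §8.2/Lemma 8.5, Thm. 9.7 and Thm. 6.6 (1) for the PAIR of
# newforms `(f, f′)` of an elliptic curve `W/ℚ` and of its quadratic twist `W′ = W^{(−1)}` at `p = 2`, the two
# dual-exponential value data LINKED on the levels `ℚ(μ_m) ∋ i` through the twist identification `T₂W′ ≅ T₂W`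
# (one named construction fact; nothing asserted)

Topic `NumberTheory/EllipticCurves`, sub-directory `Kato2004` (namespace = path). Cell `bsd-2adic`
(run/shared/lean/pub/bsd-2adic/), seat `bsd-2adic-addL2x` GEN 21 (crux stmt-BirchSwinnertonDyer-19098 `AdditiveRankZeroAtTwo`,
child C4″ stmt-BirchSwinnertonDyer-22618; repair-census entry R-B84 (1) = R-B83 (1), pen word RC-507). Companion of
`EulerSystemValues.lean` (`Kato2004.exists_eulerSystem_expStar_values`, cell b2b-bsdres; audit sheet hES PASS at `p = 2`) and of
`EulerSystemValuesMember.lean` (the member form). HONEST FRAMING: ONE `def … : Prop` construction fact (D-0014; nothing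
asserted, no `_holds` expected); no theorem about BSD; nothing is booked; no class of the cell's census closes.

## Why a PAIR fact (reading step T22 (b) of the descent sockets, odd-branch side)

The descent sockets `AddKatoTwo.KatoDescentSocketAtTwoAdditive…` of crux 19098 (file
`Summits/…/Theorems/ByReductionTypeAtTwoAdditiveKatoDescentSocketDefs.lean`) read, in step T22 (b), that the Λ-line of the
TRANSPORTED zeta class `z̃` of `f′ = f_{W′}` (Kato's Euler system for `T₂W′` over his tower `ℚ(μ_{2^∞}) ∋ i`, carried to
`𝐇¹_Γ(T₂W)` along `T₂W ≅ T₂W′ ⊗ χ₋₁` and corestricted to the `ℤ₂`-layers — the ODD branch) and the Λ-line of Kato's class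
`z(f_W)` agree at every height-one prime `𝔮 ∌ 2`. The tree PROVES this (GEN 19 `Kato2004.lengthAt_quotient_span_eq_of_…`,
GEN 20 `Kato2004.exists_finset_forall_layerEigenfunctional_lift_ne_zero_two`, GEN 21 companions) from the VALUES of the two
classes under the SAME finite-level eigenfunctionals `w = Σ_b χ(b)·J((1 ⊗ σ_b)Λ(res ·))` built from ONE value datum `Λ` on
`H¹(ℚ(μ_m), T₂W)`. The single-curve facts give, for `(W, f)` and for `(W′, f′)` SEPARATELY, abstract data `Λ`, `Λ′` («read as
`exp*_{f̄} ∘ loc_p`», §9.4) whose values are pinned only on their own classes ((C4)); no statement of the tree relates `Λ` to `Λ′`,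
although in print both ARE the dual exponential map: for `4 ∣ m` the restrictions of `T₂W` and `T₂W′` to `Gal(ℚ̄/ℚ(μ_m))`
coincide (the twist character `χ₋₁` of `ℚ(i)/ℚ` dies on `Gal(ℚ̄/ℚ(i)) ⊇ Gal(ℚ̄/ℚ(μ_m))`), `exp*` is functorial in the
`Gal(ℚ̄/ℚ(μ_m) ⊗ ℚ₂)`-representation, and the `ℚ`-structures `S(f_W) = ℚ·ω_W`, `S(f′) = ℚ·ω_{W′}` of `Fil⁰ D_dR` differ, under the
`ℚ(i)`-isomorphism `W′ ≅ W`, `(x, y) ↦ (x, i·y)` (Silverman X.2 Prop. 2.4 / X.5 Cor. 5.4), by the factor `i` (times a rational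
number: `ω_W ↦ i^{±1}·ω_{W′}`, Manin constants). This file records exactly that: ONE datum `Λ` for `W` (serving Kato's family
for `f` on all levels, VERBATIM `ZetaBody W 2 f ι κ Λ …`) and ONE datum `Λ′` for `W′` (serving Kato's family for `f′` on all
levels, VERBATIM `ZetaBody W′ 2 f′ ι κ′ Λ′ …`) with the LINK `Λ(u_* y′) = (1 ⊗ i_m)·Λ′(y′)` on every level `4 ∣ m`, where
`u : T₂W′ ≃ T₂W` is the twist identification (equivariant on `Gal(ℚ̄/ℚ(μ_m))`, `4 ∣ m`; tree THEOREM
`WeierstrassCurve.exists_tateModule_equiv_quadraticTwist_sign`), `u_*` the coefficient change on `H¹(ℚ(μ_m), ·)`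
(`Kato2004.twistH1On`), and `i_m ∈ ℚ(ζ_m)` THE square root of `−1` with `ι_m(i_m) = I` under the level's complex embedding
(this normalisation makes the clause stable under the level-wise change of embeddings (F-ι-0) of the companion file: replacing
`ι_m` by `ι_m ∘ σ_a` replaces `i_m` by `χ₋₁(a)·i_m` and `Λ, Λ′, x, x′` by their `σ_a⁻¹`-transforms, and the clause is
transported to itself; a GLOBAL sign / rational factor of the link is absorbed once and for all into `(κ′, Λ′, x′) ↦ (qκ′, qΛ′,
qx′)`, which preserves `ZetaBody` — so the displayed constant `1 ⊗ i_m` is a normalisation, not an extra claim).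

## What is transcribed, clause by clause

* the two `ZetaBody` families: VERBATIM the companion fact `exists_eulerSystem_expStar_values` for `(W, 2, f)` and for
  `(W′, 2, f′)` [Kato (8.1.3) p. 180, §8.2/Lemma 8.5 pp. 180–184, Prop. 8.12 p. 186, Thm. 9.7 p. 189, Thm. 6.6 (1) p. 163, §13.1
  (13.1.1)/Ex. 13.3 pp. 224–225; hypotheses as there: `W[2]` irreducible — equivalently `W′[2]` irreducible, `W′[2] ≅ W[2]`;
  `2 ∣ N`, `2 ∣ N′` allowed];
* the identification `u`: «`T_p(E^{(d)}) ≅ T_p(E) ⊗ χ_d`», equivariant on `Gal(ℚ̄/ℚ(√d))` [Silverman, *AEC* X.5 Cor. 5.4 with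
  III §7]; here only its equivariance on the LEVELS `Gal(ℚ̄/ℚ(μ_{2^k·∏ℓ}))`, `k ≥ 2` (which fix `i`) is displayed;
* the LINK: «`exp*` commutes with morphisms of `p`-adic representations of `Gal(K̄/K)`» [Kato §9.4 p. 188 (the dual exponential
  map of [BK90] Def. 3.10), Bloch–Kato 1990 §3] applied to `u` over `K = ℚ(μ_m) ⊗ ℚ₂`, `4 ∣ m`, together with the comparison of
  the rational de Rham lines along `W′_{ℚ(i)} ≅ W_{ℚ(i)}` [Silverman X.2 Prop. 2.4, X.5 Cor. 5.4: `ω ↦ ω/√d`] — [folklore]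
  bookkeeping, own attribution for the reading at `p = 2`.
NOT here: the definition of `exp*` or of the classes; any statement for levels `4 ∤ m`; any value of `Λ` off Kato's classes
beyond the link; Thm. 12.4–12.6; any divisibility; the twist by `−2` (see TODO); any proof. A CONSTRUCTION fact: the
identity of `u, Λ, Λ′` is displayed existentially (weaker than the transcribed statements).

## References

* K. Kato, *p-adic Hodge theory and values of zeta functions of modular forms*, Astérisque 295 (2004): §8.1 (8.1.2)–(8.1.3)
  (p. 180), §8.2 and Lemma 8.5 (pp. 180–184), Prop. 8.12 (p. 186), §9.4 (p. 188), Thm. 9.7 (p. 189), Thm. 6.6 (1) (p. 163),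
  §13.1 (13.1.1) and Ex. 13.3 (pp. 224–225), Thm. 12.5 (1) (pp. 221–222). [Kato2004Asterisque]
* S. Bloch, K. Kato, *L-functions and Tamagawa numbers of motives* (1990), §3, Def. 3.10. [BlochKato1990]
* J. H. Silverman, *The Arithmetic of Elliptic Curves*, 2nd ed. (2009), X.2 Prop. 2.4, X.5 Cor. 5.4, III §7. [SilvermanAEC2009]
* K. Rubin, *Euler Systems* (2000), Def. 2.1.1, Ch. II §4 and Ch. VI (twisting by characters of `Gal(K_∞/K)`). [Rubin2000]
* V. Pal, *Periods of quadratic twists of elliptic curves*, Proc. AMS 140 (2012) (the period ratio `Ω(E^{(d)})√|d|/Ω(E) ∈ ℚˣ`). [Pal2012]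
* Tree: `Kato2004/EulerSystemValues.lean` (`ZetaBody`, `tateRep`, `cycSubgroup`, `cycLevel`, the companion fact),
  `Kato2004/H1CoefficientChange.lean` (`twistH1On`), `TateModuleQuadraticTwistEquivProofs.lean`
  (`WeierstrassCurve.exists_tateModule_equiv_quadraticTwist_sign`), `QuadraticTwist.lean` (`quadraticTwist`); cell memo
  run/shared/lean/pub/bsd-2adic/addL2x/VERDICT-19098-addL2x-GEN21.md.
-/

noncomputable section

open scoped NumberField TensorProduct MatrixGroups
open Field IsDedekindDomain CongruenceSubgroup
open Literature.NumberTheory.GaloisRepresentations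
open Literature.NumberTheory.EllipticCurves Literature.NumberTheory.EllipticCurves.ModularForms
open Literature.NumberTheory.EllipticCurves.Kato2004.EulerSystemValues Rat.HeightOneSpectrum

namespace Literature.NumberTheory.EllipticCurves.Kato2004

/-- **Kato 2004, (8.1.3) / Example 13.3 (`a(A)`-type, `k = 2`, `F = ℚ`) with Prop. 8.12, §8.2/Lemma 8.5, Thm. 9.7 and
Thm. 6.6 (1), at `p = 2`, for the newform `f` of an elliptic curve `W/ℚ` with `W[2]` irreducible AND for the newform `f′` of
its quadratic twist `W′ = W^{(−1)}`, with LINKED dual-exponential data.** For every such `W` [structure facts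
`ContinuousSMul / Module.Free / Module.Finite ℤ_[2] (T₂W)`, `(T₂W′)` and `W′.IsElliptic` as instance BINDERS, discharged by the
tree theorems `TateModule.continuousSMul_padicInt`, `module_free/finite_tateModule_holds`, `isElliptic_quadraticTwist`], newforms
`f ∈ S₂(Γ₀(N))` of `W` and `f′ ∈ S₂(Γ₀(N′))` of `W′`, and every family of complex embeddings `ι_m : ℚ(ζ_m) → ℂ`, there are:
a continuous `ℤ₂`-linear identification `u : T₂W′ ≃ T₂W` equivariant on every level group `Gal(ℚ̄/ℚ(μ_{2^k·∏ℓ}))` with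
`k ≥ 2` (the twist identification of Silverman X.5 Cor. 5.4 — these groups fix `i`); real constants `κ, κ′ ≠ 0`; and value
data `Λ` on `H¹(ℚ(μ_m), T₂W)`, `Λ′` on `H¹(ℚ(μ_m), T₂W′)` (all levels `m = 2^k·∏ℓ`), such that
(LINK) on every level with `k ≥ 2` and for THE `i_m ∈ ℚ(ζ_m)` with `ι_m(i_m) = I`:
`Λ(u_* y′) = (1 ⊗ i_m)·Λ′(y′)` for all `y′ ∈ H¹(ℚ(μ_m), T₂W′)` [§9.4 / [BK90] 3.10: `exp*` is functorial in the
`Gal(ℚ̄/ℚ(μ_m)⊗ℚ₂)`-representation; the rational de Rham lines of `W′_{ℚ(i)} ≅ W_{ℚ(i)}` differ by `i` up to `ℚˣ`, the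
rational factor and the global sign absorbed into `(κ′, Λ′, x′)`];
(W) for all guarded data `(c, d, a, A)` of Ex. 13.3 (`A ≥ 1`, `(c, 12A) = 1`, `(d, 12N) = 1`) Kato's classes `z` and values `x`
with `ZetaBody W 2 f ι κ Λ c d a A z x` — VERBATIM the companion fact `exists_eulerSystem_expStar_values`;
(W′) the same for `(W′, f′, κ′, Λ′)` with the guard `(d, 12N′) = 1`.
A CONSTRUCTION fact; `u, Λ, Λ′` displayed existentially; nothing for levels `4 ∤ m` beyond the two families; no proof.
-- TODO(general form): every quadratic twist `W^{(d)}` with `√d ∈ ℚ(μ_{2^{k₀}})` (`d = ±2`: levels `8 ∣ m`, twist element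
-- `√d = ζ₈ ± ζ₈⁻¹`); odd `p` with `√d ∈ ℚ(μ_p)`; newforms of weight `k ≥ 2` with coefficients; `exp*` as a DEFINED map.
[cite: Kato2004Asterisque, (8.1.3) (p. 180), §8.2 and Lemma 8.5 (pp. 180–184), Prop. 8.12 (p. 186), §9.4 (p. 188), Thm. 9.7 (p. 189), Thm. 6.6 (1) (p. 163), §13.1 (13.1.1) and Ex. 13.3 (pp. 224–225)]
[cite: BlochKato1990, §3 Def. 3.10–3.11 (the exponential and dual exponential maps, functorial in V)]
[cite: SilvermanAEC2009, X.2 Prop. 2.4, X.5 Cor. 5.4 and III §7 (the ℚ(√d)-isomorphism E^{(d)} ≅ E and T_p as a functor)]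
[cite: Rubin2000, Def. 2.1.1, Ch. II §4 and Ch. VI (twisting Euler systems by characters)] -/
def exists_eulerSystem_expStar_values_negOneTwistPair_two : Prop :=
  ∀ (W : WeierstrassCurve ℚ) [W.IsElliptic]
    [ContinuousSMul ℤ_[2] (W.tateModule 2)] [Module.Free ℤ_[2] (W.tateModule 2)]
    [Module.Finite ℤ_[2] (W.tateModule 2)]
    [(W.quadraticTwist (-1)).IsElliptic]
    [ContinuousSMul ℤ_[2] ((W.quadraticTwist (-1)).tateModule 2)]
    [Module.Free ℤ_[2] ((W.quadraticTwist (-1)).tateModule 2)]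
    [Module.Finite ℤ_[2] ((W.quadraticTwist (-1)).tateModule 2)],
    W.HasIrreducibleModPGaloisRep 2 →
    ∀ {N : ℕ} [NeZero N] (f : CuspForm (Gamma0 N) 2), IsNewformOf W f →
    ∀ {N' : ℕ} [NeZero N'] (f' : CuspForm (Gamma0 N') 2), IsNewformOf (W.quadraticTwist (-1)) f' →
    ∀ (ι : (m : ℕ) → (CyclotomicField m ℚ →+* ℂ)),
    ∃ (u : (W.quadraticTwist (-1)).tateModule 2 ≃ₗ[ℤ_[2]] W.tateModule 2) (hu : Continuous u)
      (hV : ∀ k : ℕ, 2 ≤ k → ∀ (r : Finset (HeightOneSpectrum (𝓞 ℚ))) (σ : absoluteGaloisGroup ℚ),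
        σ ∈ cycSubgroup 2 k r → ∀ x : (W.quadraticTwist (-1)).tateModule 2, u (σ • x) = σ • u x),
    ∃ κ : ℝ, κ ≠ 0 ∧ ∃ κ' : ℝ, κ' ≠ 0 ∧
    ∃ (Λ : ∀ (k : ℕ) (r : Finset (HeightOneSpectrum (𝓞 ℚ))),
        H1 (tateRep W 2) (cycSubgroup 2 k r) →ₗ[ℤ_[2]] ℚ_[2] ⊗[ℚ] CyclotomicField (cycLevel 2 k r) ℚ)
      (Λ' : ∀ (k : ℕ) (r : Finset (HeightOneSpectrum (𝓞 ℚ))),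
        H1 (tateRep (W.quadraticTwist (-1)) 2) (cycSubgroup 2 k r) →ₗ[ℤ_[2]]
          ℚ_[2] ⊗[ℚ] CyclotomicField (cycLevel 2 k r) ℚ),
      -- (LINK) `Λ(u_* y′) = (1 ⊗ i_m)·Λ′(y′)` on the levels `k ≥ 2`, `ι_m(i_m) = I`
      (∀ (k : ℕ) (hk : 2 ≤ k) (r : Finset (HeightOneSpectrum (𝓞 ℚ))) (i : CyclotomicField (cycLevel 2 k r) ℚ),
        ι (cycLevel 2 k r) i = Complex.I →
        ∀ y' : H1 (tateRep (W.quadraticTwist (-1)) 2) (cycSubgroup 2 k r),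
          Λ k r (twistH1On W (W.quadraticTwist (-1)) u hu (hV k hk r) y') =
            ((1 : ℚ_[2]) ⊗ₜ[ℚ] i) * Λ' k r y') ∧
      -- (W) Kato's family for `f` with the datum `Λ` — VERBATIM `exists_eulerSystem_expStar_values` for `(W, 2, f, ι)`
      (∀ (c d a : ℤ) (A : ℕ), 0 < A → Int.gcd c (6 * 2 * A) = 1 → Int.gcd d (6 * 2 * N) = 1 →
        ∃ (z : ∀ (k : ℕ) (r : (cyclotomicLevelsRat 2 (badPlaces c d A N)).Ideals),
              H1 (tateRep W 2) ((cyclotomicLevelsRat 2 (badPlaces c d A N)).level k r.1))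
          (x : ∀ (k : ℕ) (r : (cyclotomicLevelsRat 2 (badPlaces c d A N)).Ideals),
              CyclotomicField (cycLevel 2 k r.1) ℚ),
          ZetaBody W 2 f ι κ Λ c d a A z x) ∧
      -- (W′) Kato's family for `f′` with the datum `Λ′` — VERBATIM the companion fact for `(W′, 2, f′, ι)`
      (∀ (c d a : ℤ) (A : ℕ), 0 < A → Int.gcd c (6 * 2 * A) = 1 → Int.gcd d (6 * 2 * N') = 1 →
        ∃ (z' : ∀ (k : ℕ) (r : (cyclotomicLevelsRat 2 (badPlaces c d A N')).Ideals),
              H1 (tateRep (W.quadraticTwist (-1)) 2) ((cyclotomicLevelsRat 2 (badPlaces c d A N')).level k r.1))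
          (x' : ∀ (k : ℕ) (r : (cyclotomicLevelsRat 2 (badPlaces c d A N')).Ideals),
              CyclotomicField (cycLevel 2 k r.1) ℚ),
          ZetaBody (W.quadraticTwist (-1)) 2 f' ι κ' Λ' c d a A z' x')

end Literature.NumberTheory.EllipticCurves.Kato2004

end
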